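import Summits.Ventures.PercRepro.C041TriDomStockedHost

/-!
# ROW C-041 — THEOREM (CONTRACTION OF A DOUBLE EDGE): A STATUS WITH A DOUBLE EDGE IS THE CONJECTURE ON THE
CONTRACTED HOST
(p6, gen 47; P6-TWOEXIT-LEAN.md §53 ADDENDUM 19)

A double edge `f = p–q` (present in both colours in every colouring) identifies its ends for every connectivity.
THE CONTRACTED HOST `contractHost Z₁ p q` renames the end `q` to `p` on every edge (`ren p q`: the same vertex and edge
types, `q` becomes an isolated vertex, `f` a loop at `p`), and the status `stAbs st f` makes `f` absent.
**THE REACH TRANSPORT** (`reach_contract_iff`): for any colour predicate `col` with `col f`, a vertex `y` is reached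
from `x` through `col`-edges of `Z₁` iff `ren y` is reached from `ren x` through the `col`-edges other than `f` of the
contracted host — forward, a walk of `Z₁` is a walk of the contracted host in which the steps along `f` have become
trivial (`rtg_contract_of_rtg`); backward, a walk of the contracted host lifts step by step, the two ends of an edge
being met in `Z₁` through `f` whenever their images coincide (`rtg_of_rtg_contract`, `rtg_of_ren_eq`).  Hence the red
and blue connectivities (`RdS_contract_iff`, `MgS_contract_iff`), the classes of the conjecture and of the sibling
(`cycCrossedS_contract_iff`, `topBotS_contract_iff`, `sibC₁_contract_iff`, `sibC₃_contract_iff`,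
`sibTop_contract_iff`) and the up-set statements themselves (`cycDominationS_contract_iff`,
`sibDominationS_contract_iff`) are the same on `(Z₁, st, a, b, c)` and on
`(contractHost Z₁ p q, stAbs st f, ren a, ren b, ren c)` — the colouring space is the same, so the up-sets are the
same.  The contracted status has one present edge fewer (`npres_stAbs_lt`): this is the induction step that removes
the double edges from the open core (`C041TriDomSimpleCore`).
-/

namespace PercRepro

namespace ZoneZ

namespace MultiExit

open ZoneData Finset Classical

variable {V₁ E₁ U₁ U₂ : Type} (Z₁ : ZoneData V₁ E₁ U₁ U₂)

/-! ## Renaming a vertex -/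

/-- The renaming of `q` to `p` (every other vertex is fixed). -/
noncomputable def ren (p q v : V₁) : V₁ := if v = q then p else v

/-- `q` is renamed to `p`. -/
theorem ren_q (p q : V₁) : ren p q q = p := by
  unfold ren
  rw [if_pos rfl]

/-- A vertex other than `q` is fixed. -/
theorem ren_of_ne {p q v : V₁} (h : v ≠ q) : ren p q v = v := by
  unfold ren
  rw [if_neg h]

/-- `p` is fixed. -/
theorem ren_p (p q : V₁) : ren p q p = p := by
  unfold ren
  split_ifs <;> rfl

/-- Two vertices with the same image are equal or are `p` and `q`. -/
theorem eq_or_pair_of_ren_eq {p q u v : V₁} (h : ren p q u = ren p q v) :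
    u = v ∨ (u = p ∧ v = q) ∨ (u = q ∧ v = p) := by
  unfold ren at h
  by_cases hu : u = q <;> by_cases hv : v = q
  · left
    rw [hu, hv]
  · rw [if_pos hu, if_neg hv] at h
    right; right
    exact ⟨hu, h.symm⟩
  · rw [if_neg hu, if_pos hv] at h
    right; left
    exact ⟨h, hv⟩
  · rw [if_neg hu, if_neg hv] at h
    left
    exact h

/-- The image of a vertex is `p` or the vertex itself. -/
theorem ren_eq_p_or_self (p q v : V₁) : ren p q v = p ∨ ren p q v = v := by
  unfold ren
  split_ifs
  · exact Or.inl rfl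
  · exact Or.inr rfl

/-- No vertex other than `p` is the image of `q`-valued ends: the image of a vertex is never `q` unless `p = q`. -/
theorem ren_ne_q {p q : V₁} (hpq : p ≠ q) (v : V₁) : ren p q v ≠ q := by
  unfold ren
  split_ifs with h
  · exact hpq
  · exact h

/-! ## The contracted host -/

/-- The host with `q` merged into `p`: every end equal to `q` is renamed `p` (the edge and vertex types are unchanged;
`q` becomes isolated). -/
noncomputable def contractHost (p q : V₁) : ZoneData V₁ E₁ U₁ U₂ where
  fst e := ren p q (Z₁.fst e)
  snd e := ren p q (Z₁.snd e)
  at₁ t := ren p q (Z₁.at₁ t)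
  at₂ t := ren p q (Z₁.at₂ t)

/-- An edge of `Z₁` joins the images of its ends in the contracted host. -/
theorem joins_contract_of_joins {p q : V₁} {e : E₁} {u v : V₁} (h : Z₁.Joins e u v) :
    (contractHost Z₁ p q).Joins e (ren p q u) (ren p q v) := by
  unfold ZoneData.Joins at h ⊢
  rcases h with ⟨h1, h2⟩ | ⟨h1, h2⟩
  · exact Or.inl ⟨by rw [← h1]; rfl, by rw [← h2]; rfl⟩
  · exact Or.inr ⟨by rw [← h1]; rfl, by rw [← h2]; rfl⟩

/-- An edge of the contracted host joins the images of two ends it joins in `Z₁`. -/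
theorem exists_joins_of_joins_contract {p q : V₁} {e : E₁} {u' v' : V₁}
    (h : (contractHost Z₁ p q).Joins e u' v') :
    ∃ u v : V₁, Z₁.Joins e u v ∧ ren p q u = u' ∧ ren p q v = v' := by
  unfold ZoneData.Joins at h
  rcases h with ⟨h1, h2⟩ | ⟨h1, h2⟩
  · exact ⟨Z₁.fst e, Z₁.snd e, Or.inl ⟨rfl, rfl⟩, h1, h2⟩
  · exact ⟨Z₁.snd e, Z₁.fst e, Or.inr ⟨rfl, rfl⟩, h2, h1⟩

/-- The two ends of the double edge have the same image. -/
theorem ren_eq_of_joins_pq {p q : V₁} {f : E₁} (hj : Z₁.Joins f p q) {b c : V₁} (he : Z₁.Joins f b c) :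
    ren p q b = ren p q c := by
  unfold ZoneData.Joins at hj he
  rcases he with ⟨h1, h2⟩ | ⟨h1, h2⟩ <;> rcases hj with ⟨h3, h4⟩ | ⟨h3, h4⟩
  · rw [← h1, ← h2, h3, h4, ren_p, ren_q]
  · rw [← h1, ← h2, h3, h4, ren_p, ren_q]
  · rw [← h1, ← h2, h3, h4, ren_p, ren_q]
  · rw [← h1, ← h2, h3, h4, ren_p, ren_q]

/-- No edge of the contracted host has the end `q` (unless `p = q`). -/
theorem not_touches_q {p q : V₁} (hpq : p ≠ q) (e : E₁) :
    (contractHost Z₁ p q).fst e ≠ q ∧ (contractHost Z₁ p q).snd e ≠ q :=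
  ⟨ren_ne_q hpq _, ren_ne_q hpq _⟩

/-! ## The reach transport -/

section Transport

variable {col col' : E₁ → Prop} {f : E₁} {p q : V₁}

/-- `p` reaches `q` through the double edge. -/
theorem rtg_pq (hj : Z₁.Joins f p q) (hf : col f) : Relation.ReflTransGen (AdjCol Z₁ col) p q :=
  Relation.ReflTransGen.single ⟨f, hj, hf⟩

/-- Two vertices with the same image reach each other in `Z₁` (through the double edge if they are `p` and `q`). -/
theorem rtg_of_ren_eq (hj : Z₁.Joins f p q) (hf : col f) {u v : V₁} (h : ren p q u = ren p q v) :
    Relation.ReflTransGen (AdjCol Z₁ col) u v := by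
  rcases eq_or_pair_of_ren_eq h with h | ⟨hu, hv⟩ | ⟨hu, hv⟩
  · rw [h]
  · rw [hu, hv]
    exact rtg_pq Z₁ hj hf
  · rw [hu, hv]
    exact Relation.ReflTransGen.single ⟨f, Joins_symm Z₁ hj, hf⟩

/-- FORWARD: a walk of `Z₁` is a walk of the contracted host (the steps along `f` become trivial). -/
theorem rtg_contract_of_rtg (hj : Z₁.Joins f p q) (hcol' : ∀ e, col' e ↔ col e ∧ e ≠ f) {u v : V₁}
    (h : Relation.ReflTransGen (AdjCol Z₁ col) u v) :
    Relation.ReflTransGen (AdjCol (contractHost Z₁ p q) col') (ren p q u) (ren p q v) := by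
  induction h with
  | refl => exact Relation.ReflTransGen.refl
  | @tail b c _ hbc ih =>
    obtain ⟨e, he, hce⟩ := hbc
    by_cases hef : e = f
    · rw [hef] at he
      rw [← ren_eq_of_joins_pq Z₁ hj he]
      exact ih
    · exact ih.tail ⟨e, joins_contract_of_joins Z₁ he, (hcol' e).mpr ⟨hce, hef⟩⟩

/-- BACKWARD: a walk of the contracted host lifts to a walk of `Z₁` between any two preimages of its ends. -/
theorem rtg_of_rtg_contract (hj : Z₁.Joins f p q) (hf : col f) (hcol' : ∀ e, col' e ↔ col e ∧ e ≠ f)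
    {u' v' : V₁} (h : Relation.ReflTransGen (AdjCol (contractHost Z₁ p q) col') u' v') :
    ∀ u v : V₁, ren p q u = u' → ren p q v = v' → Relation.ReflTransGen (AdjCol Z₁ col) u v := by
  induction h with
  | refl =>
    intro u v hu hv
    exact rtg_of_ren_eq Z₁ hj hf (hu.trans hv.symm)
  | @tail b' c' _ hbc ih =>
    intro u v hu hv
    obtain ⟨e, he, hce⟩ := hbc
    obtain ⟨b, c, hbc, hb, hc⟩ := exists_joins_of_joins_contract Z₁ he
    have h1 := ih u b hu hb
    have h2 : Relation.ReflTransGen (AdjCol Z₁ col) b c :=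
      Relation.ReflTransGen.single ⟨e, hbc, ((hcol' e).mp hce).1⟩
    have h3 := rtg_of_ren_eq Z₁ hj hf (col := col) (hc.trans hv.symm)
    exact (h1.trans h2).trans h3

/-- **THE REACH TRANSPORT**: reach through `col`-edges of `Z₁` is reach through the `col`-edges other than `f` of the
contracted host, between the images. -/
theorem reach_contract_iff (hj : Z₁.Joins f p q) (hf : col f) (hcol' : ∀ e, col' e ↔ col e ∧ e ≠ f) (x y : V₁) :
    y ∈ ZoneData.reach (AdjCol Z₁ col) {x} ↔
      ren p q y ∈ ZoneData.reach (AdjCol (contractHost Z₁ p q) col') {ren p q x} := by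
  rw [mem_reach_singleton, mem_reach_singleton]
  exact ⟨rtg_contract_of_rtg Z₁ hj hcol', fun h => rtg_of_rtg_contract Z₁ hj hf hcol' h x y rfl rfl⟩

end Transport

/-! ## The connectivities of a status with a double edge -/

section Status

variable [DecidableEq E₁] (st : E₁ → EStat) {f : E₁} {p q : V₁}

/-- Red under the status with `f` absent: red under `st` and not `f`. -/
theorem redE_stAbs_iff_ne (ω : E₁ → Bool) (e : E₁) : redE (stAbs st f) ω e ↔ redE st ω e ∧ e ≠ f := by
  unfold redE stAbs
  by_cases hef : e = f
  · rw [if_pos hef]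
    simp only [hef, ne_eq, not_true_eq_false, and_false, iff_false]
    rintro (h | ⟨h, _⟩) <;> exact EStat.noConfusion h
  · rw [if_neg hef]
    exact (and_iff_left hef).symm

/-- Blue under the status with `f` absent: blue under `st` and not `f`. -/
theorem blueE_stAbs_iff_ne (ω : E₁ → Bool) (e : E₁) : blueE (stAbs st f) ω e ↔ blueE st ω e ∧ e ≠ f := by
  unfold blueE stAbs
  by_cases hef : e = f
  · rw [if_pos hef]
    simp only [hef, ne_eq, not_true_eq_false, and_false, iff_false]
    rintro (h | ⟨h, _⟩) <;> exact EStat.noConfusion h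
  · rw [if_neg hef]
    exact (and_iff_left hef).symm

/-- The red connectivity of a status with the double edge `f = p–q` is that of the contracted host with `f` absent. -/
theorem RdS_contract_iff (hf : st f = EStat.double) (hj : Z₁.Joins f p q) (ω : E₁ → Bool) (k v : V₁) :
    RdS Z₁ st ω k v ↔ RdS (contractHost Z₁ p q) (stAbs st f) ω (ren p q k) (ren p q v) := by
  unfold RdS
  rw [RAdjS_eq_AdjCol Z₁, RAdjS_eq_AdjCol (contractHost Z₁ p q)]
  exact reach_contract_iff Z₁ hj (show redE st ω f from Or.inl hf) (redE_stAbs_iff_ne st ω) k v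

/-- The blue connectivity of a status with the double edge `f = p–q` is that of the contracted host with `f` absent. -/
theorem MgS_contract_iff (hf : st f = EStat.double) (hj : Z₁.Joins f p q) (ω : E₁ → Bool) (k v : V₁) :
    MgS Z₁ st ω k v ↔ MgS (contractHost Z₁ p q) (stAbs st f) ω (ren p q k) (ren p q v) := by
  unfold MgS
  rw [BAdjS_eq_AdjCol Z₁, BAdjS_eq_AdjCol (contractHost Z₁ p q)]
  exact reach_contract_iff Z₁ hj (show blueE st ω f from Or.inl hf) (blueE_stAbs_iff_ne st ω) k v

/-! ## The classes -/

variable (a b c : V₁)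

/-- The crossed classes are the same on the contracted host. -/
theorem cycCrossedS_contract_iff (hf : st f = EStat.double) (hj : Z₁.Joins f p q) (ω : E₁ → Bool) :
    CycCrossedS Z₁ a b c st ω ↔
      CycCrossedS (contractHost Z₁ p q) (ren p q a) (ren p q b) (ren p q c) (stAbs st f) ω := by
  rw [cycCrossedS_iff, cycCrossedS_iff]
  simp only [RdS_contract_iff Z₁ st hf hj ω, MgS_contract_iff Z₁ st hf hj ω]

/-- The class `(⊤, ⊥)` is the same on the contracted host. -/
theorem topBotS_contract_iff (hf : st f = EStat.double) (hj : Z₁.Joins f p q) (ω : E₁ → Bool) :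
    TopBotS Z₁ a b c st ω ↔
      TopBotS (contractHost Z₁ p q) (ren p q a) (ren p q b) (ren p q c) (stAbs st f) ω := by
  rw [topBotS_iff, topBotS_iff]
  simp only [RdS_contract_iff Z₁ st hf hj ω, MgS_contract_iff Z₁ st hf hj ω]

/-- The sibling's first class is the same on the contracted host. -/
theorem sibC₁_contract_iff (hf : st f = EStat.double) (hj : Z₁.Joins f p q) (ω : E₁ → Bool) :
    SibC₁ Z₁ a b c st ω ↔
      SibC₁ (contractHost Z₁ p q) (ren p q a) (ren p q b) (ren p q c) (stAbs st f) ω := by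
  unfold SibC₁
  simp only [RdS_contract_iff Z₁ st hf hj ω, MgS_contract_iff Z₁ st hf hj ω]

/-- The sibling's second class is the same on the contracted host. -/
theorem sibC₃_contract_iff (hf : st f = EStat.double) (hj : Z₁.Joins f p q) (ω : E₁ → Bool) :
    SibC₃ Z₁ a b c st ω ↔
      SibC₃ (contractHost Z₁ p q) (ren p q a) (ren p q b) (ren p q c) (stAbs st f) ω := by
  unfold SibC₃
  simp only [RdS_contract_iff Z₁ st hf hj ω, MgS_contract_iff Z₁ st hf hj ω]

/-- The sibling's target is the same on the contracted host. -/
theorem sibTop_contract_iff (hf : st f = EStat.double) (hj : Z₁.Joins f p q) (ω : E₁ → Bool) :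
    SibTop Z₁ a b c st ω ↔
      SibTop (contractHost Z₁ p q) (ren p q a) (ren p q b) (ren p q c) (stAbs st f) ω := by
  unfold SibTop
  simp only [RdS_contract_iff Z₁ st hf hj ω, MgS_contract_iff Z₁ st hf hj ω]

/-! ## THEOREM (CONTRACTION OF A DOUBLE EDGE) -/

variable [Fintype E₁]

/-- **THEOREM (CONTRACTION OF A DOUBLE EDGE)**: CONJECTURE (STOCHASTIC DOMINATION) on a status with the double edge
`f = p–q` follows from the conjecture on the contracted host with `f` absent and the marks renamed. -/
theorem cycDominationS_of_contract (hf : st f = EStat.double) (hj : Z₁.Joins f p q)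
    (h : CycDominationS (contractHost Z₁ p q) (ren p q a) (ren p q b) (ren p q c) (stAbs st f)) :
    CycDominationS Z₁ a b c st := by
  intro V hV
  exact (card_filter_congr' fun ω _ => and_congr_right fun _ =>
      cycCrossedS_contract_iff Z₁ st a b c hf hj ω).trans_le
    ((h V hV).trans_eq (card_filter_congr' fun ω _ => and_congr_right fun _ =>
      (topBotS_contract_iff Z₁ st a b c hf hj ω).symm))

/-- The converse: the conjecture on the status gives it on the contracted host. -/
theorem cycDominationS_contract (hf : st f = EStat.double) (hj : Z₁.Joins f p q)
    (h : CycDominationS Z₁ a b c st) :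
    CycDominationS (contractHost Z₁ p q) (ren p q a) (ren p q b) (ren p q c) (stAbs st f) := by
  intro V hV
  exact (card_filter_congr' fun ω _ => and_congr_right fun _ =>
      (cycCrossedS_contract_iff Z₁ st a b c hf hj ω).symm).trans_le
    ((h V hV).trans_eq (card_filter_congr' fun ω _ => and_congr_right fun _ =>
      topBotS_contract_iff Z₁ st a b c hf hj ω))

/-- The two forms are equivalent. -/
theorem cycDominationS_contract_iff (hf : st f = EStat.double) (hj : Z₁.Joins f p q) :
    CycDominationS Z₁ a b c st ↔
      CycDominationS (contractHost Z₁ p q) (ren p q a) (ren p q b) (ren p q c) (stAbs st f) :=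
  ⟨cycDominationS_contract Z₁ st a b c hf hj, cycDominationS_of_contract Z₁ st a b c hf hj⟩

/-- **THEOREM (CONTRACTION OF A DOUBLE EDGE)** for the sibling domination. -/
theorem sibDominationS_of_contract (hf : st f = EStat.double) (hj : Z₁.Joins f p q)
    (h : SibDominationS (contractHost Z₁ p q) (ren p q a) (ren p q b) (ren p q c) (stAbs st f)) :
    SibDominationS Z₁ a b c st := by
  intro V hV
  exact (card_filter_congr' fun ω _ => and_congr_right fun _ =>
      or_congr (sibC₁_contract_iff Z₁ st a b c hf hj ω) (sibC₃_contract_iff Z₁ st a b c hf hj ω)).trans_le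
    ((h V hV).trans_eq (card_filter_congr' fun ω _ => and_congr_right fun _ =>
      (sibTop_contract_iff Z₁ st a b c hf hj ω).symm))

/-- The converse for the sibling domination. -/
theorem sibDominationS_contract (hf : st f = EStat.double) (hj : Z₁.Joins f p q)
    (h : SibDominationS Z₁ a b c st) :
    SibDominationS (contractHost Z₁ p q) (ren p q a) (ren p q b) (ren p q c) (stAbs st f) := by
  intro V hV
  exact (card_filter_congr' fun ω _ => and_congr_right fun _ =>
      (or_congr (sibC₁_contract_iff Z₁ st a b c hf hj ω) (sibC₃_contract_iff Z₁ st a b c hf hj ω)).symm).trans_le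
    ((h V hV).trans_eq (card_filter_congr' fun ω _ => and_congr_right fun _ =>
      sibTop_contract_iff Z₁ st a b c hf hj ω))

/-- The two forms of the sibling domination are equivalent. -/
theorem sibDominationS_contract_iff (hf : st f = EStat.double) (hj : Z₁.Joins f p q) :
    SibDominationS Z₁ a b c st ↔
      SibDominationS (contractHost Z₁ p q) (ren p q a) (ren p q b) (ren p q c) (stAbs st f) :=
  ⟨sibDominationS_contract Z₁ st a b c hf hj, sibDominationS_of_contract Z₁ st a b c hf hj⟩

end Status

end MultiExit

end ZoneZ

end PercRepro
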